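import Literature.MathematicalPhysics.QuantumFieldTheory.PlaquetteChains
import HarnessLib

/-!
# Cube fields on a region of `ℤ^d` as 3-chains (potentials of the dual representation)

Dictionary file of the proof programme of the named fact
`Literature.MathematicalPhysics.QuantumFieldTheory.FrohlichSpencerU1PerimeterLawD4`
(companion of `PlaquetteChains`). In the dual representation of the `U(1)` theory
(Fröhlich–Spencer 1982 §2.4) the closed integer plaquette field `n` (`δn = 0`) is written as the
(co)boundary of an integer potential `α` on the dual lattice (`*n = dα`, §2.4 (2.21)–(2.22)); in the
tree's chain language on `ℤ^d` itself the potentials are fields on the *elementary cubes* of the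
region and the map `α ↦ dα` is the boundary `∂₃` of 3-chains (`CubicalChainsHodge.div₃`). This file
sets up the cubes and this map:

* `cubesIn Λ` — the cubes `(x; i, j, k)`, `i < j < k`, all of whose eight corners lie in `Λ`;
  `cubeChain q` — the elementary (totally alternating) 3-chain of a cube; `potChain Λ h = ∑ h_q ·
  cubeChain q` — the 3-chain of a cube field `h` ("potential"), alternating, finitely supported,
  with value `h_q` on `q` (`potChain_apply_of_mem`);
* `div₃ (potChain Λ h)` is an alternating 2-chain supported on the plaquettes of `Λ`
  (`mem_or_mem_of_div₃_potChain_ne_zero`), hence the 2-chain of the plaquette field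
  `bdPot Λ h := ofChain Λ (div₃ (potChain Λ h))` (`fluxChain_bdPot`), which is *closed*:
  `div₂ (fluxChain Λ (bdPot Λ h)) = 0` (`div₂_fluxChain_bdPot`), i.e. for integer potentials
  `∑ₚ (bdPot h)ₚ ∂p = 0` (`sum_bdPot_smul_plaqCurrent`) — `δ(dα) = 0`.
* Linearity of `potChain` and `bdPot`, and compatibility with ring homomorphisms of the
  coefficients (`bdPot_intCast`); `ofChain₃` inverts `potChain` (`ofChain₃_potChain`,
  `potChain_ofChain₃`, via the extensionality principle `LatticeChain.ext_of_alt₃` for totally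
  alternating 3-tensors).
* **`exists_bdPot_eq`** (Poincaré lemma for the cube, plaquette-field language): in
  `Λ = {-m,…,m}^d` every integer plaquette field with `∑ₚ cₚ ∂p = 0` is `bdPot Λ h` for an integer
  potential `h` — from `CubicalChainsPoincare.exists_bd₃_eq_of_bd₂_eq_zero`; real form
  `exists_bdPot_intCast_eq`. Hence the closed-flux sums of `U1DualFluxEnsemble` are sums over
  potentials modulo `ker bdPot`, the starting point of Fröhlich–Spencer's §2.5–2.6.

Everything is proved; no named fact is introduced.

## References

* J. Fröhlich, T. Spencer, Comm. Math. Phys. 83 (1982) 411–454, §2.3 (cell complex, `d`, `δ`,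
  Lemma 1), §2.4 (2.21)–(2.22) (`*n = dα`). [FrohlichSpencerCMP1982]
-/

open Finset Function Literature.Probability.LatticeModels
open Literature.Probability.LatticeModels renaming Site → ZdSite

noncomputable section

namespace Literature.MathematicalPhysics.QuantumFieldTheory

open LatticeForm (e)
open LatticeChain

variable {d : ℕ}

/-! ### Cubes of a region -/

/-- Cube labels of `ℤ^d`: a base point and three directions; only the labels with `i < j < k` are
genuine cubes. [folklore] -/
abbrev Cube (d : ℕ) : Type := ZdSite d × Fin d × Fin d × Fin d

/-- **The cubes of a finite region** `Λ ⊆ ℤ^d`: labels `(x; i, j, k)` with `i < j < k` such that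
the eight corners `x + S`, `S ⊆ {eᵢ, eⱼ, e_k}`, all lie in `Λ`. [folklore] -/
def cubesIn (Λ : Finset (ZdSite d)) : Finset (Cube d) :=
  (Λ ×ˢ (Finset.univ ×ˢ (Finset.univ ×ˢ Finset.univ))).filter fun q =>
    q.2.1 < q.2.2.1 ∧ q.2.2.1 < q.2.2.2 ∧
      q.1 + e q.2.1 ∈ Λ ∧ q.1 + e q.2.2.1 ∈ Λ ∧ q.1 + e q.2.2.2 ∈ Λ ∧
      q.1 + e q.2.1 + e q.2.2.1 ∈ Λ ∧ q.1 + e q.2.1 + e q.2.2.2 ∈ Λ ∧ q.1 + e q.2.2.1 + e q.2.2.2 ∈ Λ ∧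
      q.1 + e q.2.1 + e q.2.2.1 + e q.2.2.2 ∈ Λ

variable {Λ : Finset (ZdSite d)}

/-- Membership in `cubesIn Λ`. [folklore] -/
theorem mem_cubesIn {q : Cube d} :
    q ∈ cubesIn Λ ↔ q.1 ∈ Λ ∧ q.2.1 < q.2.2.1 ∧ q.2.2.1 < q.2.2.2 ∧
      q.1 + e q.2.1 ∈ Λ ∧ q.1 + e q.2.2.1 ∈ Λ ∧ q.1 + e q.2.2.2 ∈ Λ ∧
      q.1 + e q.2.1 + e q.2.2.1 ∈ Λ ∧ q.1 + e q.2.1 + e q.2.2.2 ∈ Λ ∧ q.1 + e q.2.2.1 + e q.2.2.2 ∈ Λ ∧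
      q.1 + e q.2.1 + e q.2.2.1 + e q.2.2.2 ∈ Λ := by
  simp only [cubesIn, Finset.mem_filter, Finset.mem_product, Finset.mem_univ, and_true]

/-- The directions of a cube of `Λ` are pairwise distinct. [folklore] -/
theorem dirs_ne_of_mem_cubesIn {q : Cube d} (hq : q ∈ cubesIn Λ) :
    q.2.1 ≠ q.2.2.1 ∧ q.2.2.1 ≠ q.2.2.2 ∧ q.2.1 ≠ q.2.2.2 := by
  obtain ⟨-, h1, h2, -⟩ := mem_cubesIn.1 hq
  exact ⟨h1.ne, h2.ne, (h1.trans h2).ne⟩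

/-! ### The elementary 3-chain of a cube -/

section CubeChain

variable {A : Type*} [CommRing A]

/-- The indicator of one ordered cube label. [folklore] -/
def cubeInd (q : Cube d) (y : ZdSite d) (a b c : Fin d) : A := if (y, a, b, c) = q then 1 else 0

/-- **The elementary 3-chain of the oriented cube** `q = (x; i, j, k)`: the antisymmetrisation of
its indicator, `+1` on the even and `-1` on the odd rearrangements of `(i, j, k)` at the base point
`x`, `0` elsewhere (and `0` if two directions coincide). [folklore] -/
def cubeChain (q : Cube d) : ZdSite d → Fin d → Fin d → Fin d → A :=
  fun y a b c => cubeInd q y a b c - cubeInd q y b a c - cubeInd q y a c b - cubeInd q y c b a +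
    cubeInd q y b c a + cubeInd q y c a b

/-- `cubeChain` is alternating in the first two directions. [folklore] -/
theorem cubeChain_swap₁₂ (q : Cube d) (y : ZdSite d) (a b c : Fin d) :
    (cubeChain q y b a c : A) = -cubeChain q y a b c := by
  simp only [cubeChain]; abel

/-- `cubeChain` is alternating in the last two directions. [folklore] -/
theorem cubeChain_swap₂₃ (q : Cube d) (y : ZdSite d) (a b c : Fin d) :
    (cubeChain q y a c b : A) = -cubeChain q y a b c := by
  simp only [cubeChain]; abel

/-- `cubeChain` is invariant under cyclic rearrangement. [folklore] -/
theorem cubeChain_cyclic (q : Cube d) (y : ZdSite d) (a b c : Fin d) :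
    (cubeChain q y b c a : A) = cubeChain q y a b c := by
  simp only [cubeChain]; abel

/-- The indicator vanishes away from the base point. [folklore] -/
theorem cubeInd_eq_zero_of_ne {q : Cube d} {y : ZdSite d} (h : y ≠ q.1) (a b c : Fin d) :
    (cubeInd q y a b c : A) = 0 := by
  simp only [cubeInd]
  rw [if_neg]
  exact fun h' => h (congrArg Prod.fst h')

/-- `cubeChain q` vanishes away from the base point of `q`. [folklore] -/
theorem cubeChain_eq_zero_of_ne {q : Cube d} {y : ZdSite d} (h : y ≠ q.1) (a b c : Fin d) :
    (cubeChain q y a b c : A) = 0 := by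
  simp only [cubeChain, cubeInd_eq_zero_of_ne h, sub_zero, add_zero]

/-- If the indicator of `q` fires at `(y; a, b, c)` then `y` is the base point and `a, b, c` are
the directions of `q` in this order. [folklore] -/
theorem cubeInd_ne_zero_imp {q : Cube d} {y : ZdSite d} {a b c : Fin d}
    (h : (cubeInd q y a b c : A) ≠ 0) : y = q.1 ∧ a = q.2.1 ∧ b = q.2.2.1 ∧ c = q.2.2.2 := by
  simp only [cubeInd, ne_eq, ite_eq_right_iff, Classical.not_imp] at h
  obtain ⟨h, -⟩ := h
  exact ⟨congrArg Prod.fst h, congrArg (fun r : Cube d => r.2.1) h,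
    congrArg (fun r : Cube d => r.2.2.1) h, congrArg (fun r : Cube d => r.2.2.2) h⟩

/-- **Where `cubeChain q` does not vanish**: at the base point of `q`, on rearrangements of its
directions. [folklore] -/
theorem cubeChain_ne_zero_imp {q : Cube d} {y : ZdSite d} {a b c : Fin d}
    (h : (cubeChain q y a b c : A) ≠ 0) :
    y = q.1 ∧ (a = q.2.1 ∨ a = q.2.2.1 ∨ a = q.2.2.2) ∧ (b = q.2.1 ∨ b = q.2.2.1 ∨ b = q.2.2.2) ∧
      (c = q.2.1 ∨ c = q.2.2.1 ∨ c = q.2.2.2) := by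
  by_contra hcon
  apply h
  have hz : ∀ a' b' c' : Fin d, ¬(y = q.1 ∧ (a' = q.2.1 ∨ a' = q.2.2.1 ∨ a' = q.2.2.2) ∧
      (b' = q.2.1 ∨ b' = q.2.2.1 ∨ b' = q.2.2.2) ∧ (c' = q.2.1 ∨ c' = q.2.2.1 ∨ c' = q.2.2.2)) →
      (cubeInd q y a' b' c' : A) = 0 := by
    intro a' b' c' hn
    by_contra h0
    obtain ⟨h1, h2, h3, h4⟩ := cubeInd_ne_zero_imp h0
    exact hn ⟨h1, Or.inl h2, Or.inr (Or.inl h3), Or.inr (Or.inr h4)⟩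
  simp only [cubeChain]
  rw [hz a b c hcon, hz b a c (fun ⟨h1, h2, h3, h4⟩ => hcon ⟨h1, h3, h2, h4⟩),
    hz a c b (fun ⟨h1, h2, h3, h4⟩ => hcon ⟨h1, h2, h4, h3⟩),
    hz c b a (fun ⟨h1, h2, h3, h4⟩ => hcon ⟨h1, h4, h3, h2⟩),
    hz b c a (fun ⟨h1, h2, h3, h4⟩ => hcon ⟨h1, h4, h2, h3⟩),
    hz c a b (fun ⟨h1, h2, h3, h4⟩ => hcon ⟨h1, h3, h4, h2⟩)]
  ring

/-- `cubeChain q` vanishes when the first two directions coincide. [folklore] -/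
theorem cubeChain_diag₁₂ (q : Cube d) (y : ZdSite d) (a c : Fin d) : (cubeChain q y a a c : A) = 0 := by
  simp only [cubeChain]; abel

/-- `cubeChain q` vanishes when the last two directions coincide. [folklore] -/
theorem cubeChain_diag₂₃ (q : Cube d) (y : ZdSite d) (a b : Fin d) : (cubeChain q y a b b : A) = 0 := by
  simp only [cubeChain]; abel

/-- `cubeChain q` vanishes when the outer two directions coincide. [folklore] -/
theorem cubeChain_diag₁₃ (q : Cube d) (y : ZdSite d) (a b : Fin d) : (cubeChain q y a b a : A) = 0 := by
  simp only [cubeChain]; abel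

/-- The directions of a non-vanishing entry of `cubeChain q` are pairwise distinct. [folklore] -/
theorem cubeChain_ne_zero_dirs_ne {q : Cube d} {y : ZdSite d} {a b c : Fin d}
    (h : (cubeChain q y a b c : A) ≠ 0) : a ≠ b ∧ b ≠ c ∧ a ≠ c := by
  refine ⟨?_, ?_, ?_⟩
  · rintro rfl; exact h (cubeChain_diag₁₂ q y a c)
  · rintro rfl; exact h (cubeChain_diag₂₃ q y a b)
  · rintro rfl; exact h (cubeChain_diag₁₃ q y a b)

/-- The value of `cubeChain q` on `q` itself in its own order is `1` (distinct directions). [folklore] -/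
theorem cubeChain_self {q : Cube d} (hq : q.2.1 ≠ q.2.2.1 ∧ q.2.2.1 ≠ q.2.2.2 ∧ q.2.1 ≠ q.2.2.2) :
    (cubeChain q q.1 q.2.1 q.2.2.1 q.2.2.2 : A) = 1 := by
  obtain ⟨h12, h23, h13⟩ := hq
  have hne : ∀ a b c : Fin d, ¬(a = q.2.1 ∧ b = q.2.2.1 ∧ c = q.2.2.2) → (cubeInd q q.1 a b c : A) = 0 := by
    intro a b c hn
    by_contra h0
    obtain ⟨-, h2, h3, h4⟩ := cubeInd_ne_zero_imp h0
    exact hn ⟨h2, h3, h4⟩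
  have hself : (cubeInd q q.1 q.2.1 q.2.2.1 q.2.2.2 : A) = 1 := by simp [cubeInd]
  simp only [cubeChain]
  rw [hself, hne q.2.2.1 q.2.1 q.2.2.2 (fun h => h12 h.1.symm), hne q.2.1 q.2.2.2 q.2.2.1 (fun h => h23 h.2.2),
    hne q.2.2.2 q.2.2.1 q.2.1 (fun h => h13 h.1.symm), hne q.2.2.1 q.2.2.2 q.2.1 (fun h => h12 h.1.symm),
    hne q.2.2.2 q.2.1 q.2.2.1 (fun h => h13 h.1.symm)]
  ring

end CubeChain

/-! ### The 3-chain of a cube field (potential) -/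

section PotChain

variable {A : Type*} [CommRing A]

variable (Λ) in
/-- **The 3-chain of a cube field** (potential) `h` on the cubes of `Λ`:
`potChain Λ h = ∑_q h_q · cubeChain q` (pointwise). [folklore] -/
def potChain (h : ↥(cubesIn Λ) → A) : ZdSite d → Fin d → Fin d → Fin d → A :=
  fun y a b c => ∑ q, h q * cubeChain (q : Cube d) y a b c

/-- `potChain` is alternating in the first two directions. [folklore] -/
theorem potChain_swap₁₂ (h : ↥(cubesIn Λ) → A) (y : ZdSite d) (a b c : Fin d) :
    potChain Λ h y b a c = -potChain Λ h y a b c := by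
  simp only [potChain, ← Finset.sum_neg_distrib, ← mul_neg]
  exact Finset.sum_congr rfl fun q _ => by rw [cubeChain_swap₁₂]

/-- `potChain` is alternating in the last two directions. [folklore] -/
theorem potChain_swap₂₃ (h : ↥(cubesIn Λ) → A) (y : ZdSite d) (a b c : Fin d) :
    potChain Λ h y a c b = -potChain Λ h y a b c := by
  simp only [potChain, ← Finset.sum_neg_distrib, ← mul_neg]
  exact Finset.sum_congr rfl fun q _ => by rw [cubeChain_swap₂₃]

/-- `potChain` is invariant under cyclic rearrangement of the directions. [folklore] -/
theorem potChain_cyclic (h : ↥(cubesIn Λ) → A) (y : ZdSite d) (a b c : Fin d) :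
    potChain Λ h y b c a = potChain Λ h y a b c := by
  simp only [potChain]
  exact Finset.sum_congr rfl fun q _ => by rw [cubeChain_cyclic]

/-- **The value of `potChain Λ h` on a cube of `Λ` (in its own order) is `h_q`.** [folklore] -/
theorem potChain_apply_of_mem (h : ↥(cubesIn Λ) → A) {q : Cube d} (hq : q ∈ cubesIn Λ) :
    potChain Λ h q.1 q.2.1 q.2.2.1 q.2.2.2 = h ⟨q, hq⟩ := by
  unfold potChain
  rw [Finset.sum_eq_single ⟨q, hq⟩]
  · rw [show ((⟨q, hq⟩ : ↥(cubesIn Λ)) : Cube d) = q from rfl,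
      cubeChain_self (dirs_ne_of_mem_cubesIn hq), mul_one]
  · intro q' _ hq'
    -- `cubeChain q'` vanishes at `(q.1; q.2.1, q.2.2.1, q.2.2.2)` unless `q' = q`
    by_contra hne
    have h0 : (cubeChain (q' : Cube d) q.1 q.2.1 q.2.2.1 q.2.2.2 : A) ≠ 0 := fun h0 => hne (by rw [h0, mul_zero])
    obtain ⟨hy, ha, hb, hc⟩ := cubeChain_ne_zero_imp h0
    obtain ⟨-, h1', h2', -⟩ := mem_cubesIn.1 q'.2
    obtain ⟨-, h1, h2, -⟩ := mem_cubesIn.1 hq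
    apply hq'
    apply Subtype.ext
    show (q' : Cube d) = q
    -- both direction triples are increasing and are rearrangements of each other
    have hdirs : (q' : Cube d).2.1 = q.2.1 ∧ (q' : Cube d).2.2.1 = q.2.2.1 ∧ (q' : Cube d).2.2.2 = q.2.2.2 := by
      omega
    exact Prod.ext hy.symm (Prod.ext hdirs.1 (Prod.ext hdirs.2.1 hdirs.2.2))
  · intro h'; exact absurd (Finset.mem_univ _) h'

/-- `potChain Λ h` vanishes at `(y; a, b, c)` unless `y` is the base point of a cube of `Λ` whose
directions are `a, b, c` in some order. [folklore] -/
theorem exists_of_potChain_ne_zero (h : ↥(cubesIn Λ) → A) {y : ZdSite d} {a b c : Fin d}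
    (hne : potChain Λ h y a b c ≠ 0) :
    ∃ q ∈ cubesIn Λ, y = q.1 ∧ (a = q.2.1 ∨ a = q.2.2.1 ∨ a = q.2.2.2) ∧
      (b = q.2.1 ∨ b = q.2.2.1 ∨ b = q.2.2.2) ∧ (c = q.2.1 ∨ c = q.2.2.1 ∨ c = q.2.2.2) ∧
      a ≠ b ∧ b ≠ c ∧ a ≠ c := by
  obtain ⟨q, -, hq⟩ := Finset.exists_ne_zero_of_sum_ne_zero hne
  have h0 : (cubeChain (q : Cube d) y a b c : A) ≠ 0 := fun h0 => hq (by rw [h0, mul_zero])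
  obtain ⟨hy, ha, hb, hc⟩ := cubeChain_ne_zero_imp h0
  exact ⟨q, q.2, hy, ha, hb, hc, cubeChain_ne_zero_dirs_ne h0⟩

/-- `potChain Λ h` is finitely supported (base points lie in `Λ`). [folklore] -/
theorem hasFiniteSupport_potChain (h : ↥(cubesIn Λ) → A) : HasFiniteSupport (potChain Λ h) := by
  refine (Λ.finite_toSet).subset fun y hy => ?_
  simp only [Function.mem_support, ne_eq] at hy
  simp only [Finset.mem_coe]
  by_contra hcon
  apply hy
  funext a b c
  by_contra h0
  obtain ⟨q, hq, hyq, -⟩ := exists_of_potChain_ne_zero h h0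
  exact hcon (hyq ▸ (mem_cubesIn.1 hq).1)

/-- `potChain` is additive. [folklore] -/
theorem potChain_add (h h' : ↥(cubesIn Λ) → A) :
    potChain Λ (h + h') = potChain Λ h + potChain Λ h' := by
  funext y a b c
  simp only [potChain, Pi.add_apply, add_mul, Finset.sum_add_distrib]

/-- `potChain` of the zero field. [folklore] -/
theorem potChain_zero : potChain Λ (0 : ↥(cubesIn Λ) → A) = 0 := by
  funext y a b c
  simp [potChain]

/-- `potChain` is odd. [folklore] -/
theorem potChain_neg (h : ↥(cubesIn Λ) → A) : potChain Λ (-h) = -potChain Λ h := by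
  funext y a b c
  simp only [potChain, Pi.neg_apply, neg_mul, Finset.sum_neg_distrib]

/-- `potChain` is subtractive. [folklore] -/
theorem potChain_sub (h h' : ↥(cubesIn Λ) → A) :
    potChain Λ (h - h') = potChain Λ h - potChain Λ h' := by
  rw [sub_eq_add_neg, potChain_add, potChain_neg, ← sub_eq_add_neg]

/-- `potChain` is homogeneous. [folklore] -/
theorem potChain_smul (r : A) (h : ↥(cubesIn Λ) → A) : potChain Λ (r • h) = r • potChain Λ h := by
  funext y a b c
  simp only [potChain, Pi.smul_apply, smul_eq_mul, mul_assoc, Finset.mul_sum]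

/-- `potChain` commutes with ring homomorphisms of the coefficients. [folklore] -/
theorem potChain_map {B : Type*} [CommRing B] (f : A →+* B) (h : ↥(cubesIn Λ) → A)
    (y : ZdSite d) (a b c : Fin d) : potChain Λ (fun q => f (h q)) y a b c = f (potChain Λ h y a b c) := by
  simp only [potChain, map_sum, map_mul, cubeChain, cubeInd, map_sub, map_add, apply_ite f, map_one,
    map_zero]

end PotChain

/-! ### Corners of a cube of `Λ` -/

section Corners

/-- A corner `x + e_a` of a cube of `Λ` lies in `Λ`. [folklore] -/
theorem corner₁_mem {q : Cube d} (hq : q ∈ cubesIn Λ) {a : Fin d}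
    (ha : a = q.2.1 ∨ a = q.2.2.1 ∨ a = q.2.2.2) : q.1 + e a ∈ Λ := by
  obtain ⟨-, -, -, hi, hj, hk, -⟩ := mem_cubesIn.1 hq
  rcases ha with rfl | rfl | rfl
  exacts [hi, hj, hk]

/-- A corner `x + e_a + e_b` (`a ≠ b`) of a cube of `Λ` lies in `Λ`. [folklore] -/
theorem corner₂_mem {q : Cube d} (hq : q ∈ cubesIn Λ) {a b : Fin d}
    (ha : a = q.2.1 ∨ a = q.2.2.1 ∨ a = q.2.2.2) (hb : b = q.2.1 ∨ b = q.2.2.1 ∨ b = q.2.2.2)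
    (hab : a ≠ b) : q.1 + e a + e b ∈ Λ := by
  obtain ⟨-, -, -, -, -, -, hij, hik, hjk, -⟩ := mem_cubesIn.1 hq
  rcases ha with rfl | rfl | rfl <;> rcases hb with rfl | rfl | rfl
  all_goals first
    | exact absurd rfl hab
    | exact hij | exact hik | exact hjk
    | (rw [add_right_comm]; first | exact hij | exact hik | exact hjk)

/-- The far corner `x + e_a + e_b + e_c` (`a, b, c` distinct) of a cube of `Λ` lies in `Λ`. [folklore] -/
theorem corner₃_mem {q : Cube d} (hq : q ∈ cubesIn Λ) {a b c : Fin d}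
    (ha : a = q.2.1 ∨ a = q.2.2.1 ∨ a = q.2.2.2) (hb : b = q.2.1 ∨ b = q.2.2.1 ∨ b = q.2.2.2)
    (hc : c = q.2.1 ∨ c = q.2.2.1 ∨ c = q.2.2.2) (hab : a ≠ b) (hbc : b ≠ c) (hac : a ≠ c) :
    q.1 + e a + e b + e c ∈ Λ := by
  obtain ⟨-, -, -, -, -, -, -, -, -, h⟩ := mem_cubesIn.1 hq
  rcases ha with rfl | rfl | rfl <;> rcases hb with rfl | rfl | rfl <;> rcases hc with rfl | rfl | rfl
  all_goals first
    | exact absurd rfl hab | exact absurd rfl hbc | exact absurd rfl hac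
    | exact h | (convert h using 1; abel)

end Corners

/-! ### The boundary of a potential is a closed plaquette field of `Λ` -/

section Boundary

variable {A : Type*} [CommRing A]

namespace LatticeChain

/-- `div₃` is alternating when its argument is alternating in the last two directions. [folklore] -/
theorem div₃_swap {Q : ZdSite d → Fin d → Fin d → Fin d → A} (hQ : ∀ y a b c, Q y a c b = -Q y a b c)
    (y : ZdSite d) (k l : Fin d) : div₃ Q y l k = -div₃ Q y k l := by
  simp only [div₃, ← Finset.sum_neg_distrib]
  exact Finset.sum_congr rfl fun j _ => by rw [hQ (y - e j) j k l, hQ y j k l]; ring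

/-- `div₃` is additive. [folklore] -/
theorem div₃_add (Q Q' : ZdSite d → Fin d → Fin d → Fin d → A) : div₃ (Q + Q') = div₃ Q + div₃ Q' := by
  funext y k l
  simp only [div₃, Pi.add_apply, ← Finset.sum_add_distrib]
  exact Finset.sum_congr rfl fun j _ => by ring

/-- `div₃` is homogeneous. [folklore] -/
theorem div₃_smul (r : A) (Q : ZdSite d → Fin d → Fin d → Fin d → A) : div₃ (r • Q) = r • div₃ Q := by
  funext y k l
  simp only [div₃, Pi.smul_apply, smul_eq_mul, Finset.mul_sum, mul_sub]

/-- `div₃` commutes with ring homomorphisms of the coefficients. [folklore] -/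
theorem div₃_map {B : Type*} [CommRing B] (f : A →+* B) (Q : ZdSite d → Fin d → Fin d → Fin d → A)
    (y : ZdSite d) (k l : Fin d) : div₃ (fun z a b c => f (Q z a b c)) y k l = f (div₃ Q y k l) := by
  simp only [div₃, map_sum, map_sub]

end LatticeChain

/-- **The boundary of a potential is supported on the plaquettes of `Λ`**: where
`div₃ (potChain Λ h)` does not vanish, the triple or its reverse is a plaquette of `Λ` (a face of a
cube of `Λ`). [folklore] -/
theorem mem_or_mem_of_div₃_potChain_ne_zero (h : ↥(cubesIn Λ) → A) {y : ZdSite d} {k l : Fin d}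
    (hne : div₃ (potChain Λ h) y k l ≠ 0) : (y, k, l) ∈ plaquettesIn Λ ∨ (y, l, k) ∈ plaquettesIn Λ := by
  -- one term of the divergence is non-zero
  obtain ⟨j, -, hj⟩ := Finset.exists_ne_zero_of_sum_ne_zero hne
  -- the four corners of the plaquette `(y; k, l)` lie in `Λ`, and `k ≠ l`
  have hcorners : y ∈ Λ ∧ y + e k ∈ Λ ∧ y + e l ∈ Λ ∧ y + e k + e l ∈ Λ ∧ k ≠ l := by
    by_cases h0 : potChain Λ h y j k l ≠ 0
    · obtain ⟨q, hq, hyq, hjq, hkq, hlq, hjk, hkl, hjl⟩ := exists_of_potChain_ne_zero h h0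
      subst hyq
      exact ⟨(mem_cubesIn.1 hq).1, corner₁_mem hq hkq, corner₁_mem hq hlq, corner₂_mem hq hkq hlq hkl, hkl⟩
    · have h1 : potChain Λ h (y - e j) j k l ≠ 0 := by
        intro h1; apply hj; rw [h1, not_not.1 h0, sub_zero]
      obtain ⟨q, hq, hyq, hjq, hkq, hlq, hjk, hkl, hjl⟩ := exists_of_potChain_ne_zero h h1
      have hy : y = q.1 + e j := by rw [← hyq, sub_add_cancel]
      rw [hy]
      refine ⟨corner₁_mem hq hjq, corner₂_mem hq hjq hkq hjk, corner₂_mem hq hjq hlq hjl, ?_, hkl⟩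
      rw [add_assoc (q.1 + e j), ← add_assoc (q.1 + e j)]
      exact corner₃_mem hq hjq hkq hlq hjk hkl hjl
  obtain ⟨hy, hyk, hyl, hykl, hkl⟩ := hcorners
  rcases lt_or_gt_of_ne hkl with hlt | hlt
  · left
    exact Plaq.mem_plaquettesIn.2 ⟨hy, hlt, hyk, hyl, hykl⟩
  · right
    refine Plaq.mem_plaquettesIn.2 ⟨hy, hlt, hyl, hyk, ?_⟩
    simpa only [add_right_comm] using hykl

variable (Λ) in
/-- **The boundary of a potential** as a plaquette field of `Λ`: `bdPot Λ h = ∂₃ (potChain Λ h)`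
read on the plaquettes of `Λ` (Fröhlich–Spencer's `dα`). [cite: FrohlichSpencerCMP1982, §2.4 (2.21)–(2.22)] -/
def bdPot (h : ↥(cubesIn Λ) → A) : ↥(plaquettesIn Λ) → A := ofChain Λ (div₃ (potChain Λ h))

/-- `bdPot Λ h` read as a 2-chain is `div₃ (potChain Λ h)`. [folklore] -/
theorem fluxChain_bdPot (h : ↥(cubesIn Λ) → A) : fluxChain Λ (bdPot Λ h) = div₃ (potChain Λ h) :=
  fluxChain_ofChain (fun y k l => LatticeChain.div₃_swap (potChain_swap₂₃ h) y k l)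
    fun _ _ _ hne => mem_or_mem_of_div₃_potChain_ne_zero h hne

/-- Evaluation of `bdPot`. [folklore] -/
theorem bdPot_apply (h : ↥(cubesIn Λ) → A) (p : ↥(plaquettesIn Λ)) :
    bdPot Λ h p = div₃ (potChain Λ h) (p : Plaq d).1 (p : Plaq d).2.1 (p : Plaq d).2.2 := rfl

/-- **`δ(dα) = 0`: the boundary of a potential is a closed plaquette field.** [cite: FrohlichSpencerCMP1982, §2.3 (2.13) (δδ = 0), §2.4 (2.21)] -/
theorem div₂_fluxChain_bdPot [IsAddTorsionFree A] (h : ↥(cubesIn Λ) → A) :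
    div₂ (fluxChain Λ (bdPot Λ h)) = 0 := by
  rw [fluxChain_bdPot]
  exact div₂_div₃ fun y i j k => potChain_swap₁₂ h y i j k

/-- The closed-flux constraint of `U1DualFluxEnsemble` holds for boundaries of integer potentials:
`∑ₚ (∂h)ₚ • ∂p = 0`. [folklore] -/
theorem sum_bdPot_smul_plaqCurrent (h : ↥(cubesIn Λ) → ℤ) :
    ∑ p, bdPot Λ h p • plaqCurrent (p : Plaq d) = 0 :=
  (sum_smul_plaqCurrent_eq_zero_iff _).2 (div₂_fluxChain_bdPot h)

/-- `bdPot` is additive. [folklore] -/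
theorem bdPot_add (h h' : ↥(cubesIn Λ) → A) : bdPot Λ (h + h') = bdPot Λ h + bdPot Λ h' := by
  funext p
  simp only [bdPot, ofChain, potChain_add, LatticeChain.div₃_add, Pi.add_apply]

/-- `bdPot` is homogeneous. [folklore] -/
theorem bdPot_smul (r : A) (h : ↥(cubesIn Λ) → A) : bdPot Λ (r • h) = r • bdPot Λ h := by
  funext p
  simp only [bdPot, ofChain, potChain_smul, LatticeChain.div₃_smul, Pi.smul_apply]

/-- `bdPot` of the zero potential. [folklore] -/
theorem bdPot_zero : bdPot Λ (0 : ↥(cubesIn Λ) → A) = 0 := by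
  have h := bdPot_smul (0 : A) (0 : ↥(cubesIn Λ) → A)
  rwa [zero_smul, zero_smul] at h

/-- `bdPot` is odd. [folklore] -/
theorem bdPot_neg (h : ↥(cubesIn Λ) → A) : bdPot Λ (-h) = -bdPot Λ h := by
  have h1 := bdPot_smul (-1 : A) h
  rwa [neg_one_smul, neg_one_smul] at h1

/-- `bdPot` is subtractive. [folklore] -/
theorem bdPot_sub (h h' : ↥(cubesIn Λ) → A) : bdPot Λ (h - h') = bdPot Λ h - bdPot Λ h' := by
  rw [sub_eq_add_neg, bdPot_add, bdPot_neg, ← sub_eq_add_neg]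

/-- `bdPot` of the cast of an integer potential is the cast of its `bdPot`. [folklore] -/
theorem bdPot_intCast (h : ↥(cubesIn Λ) → ℤ) (p : ↥(plaquettesIn Λ)) :
    bdPot Λ (fun q => (h q : ℝ)) p = ((bdPot Λ h p : ℤ) : ℝ) := by
  simp only [bdPot_apply]
  have hmap : potChain Λ (fun q => (h q : ℝ)) = fun z a b c => (Int.castRingHom ℝ) (potChain Λ h z a b c) := by
    funext z a b c; exact potChain_map (Int.castRingHom ℝ) h z a b c
  rw [hmap, LatticeChain.div₃_map]
  rfl

end Boundary

/-! ### Alternating 3-tensors are determined by their increasing entries -/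

section Ext

variable {A : Type*} [CommRing A] [IsAddTorsionFree A]

/-- Consequences of alternation under the two adjacent transpositions (no `2`-torsion): vanishing
on the three diagonals, cyclic invariance, and the sign of the outer transposition. [folklore] -/
theorem LatticeChain.alt₃_consequences {S : ZdSite d → Fin d → Fin d → Fin d → A}
    (s₁₂ : ∀ y a b c, S y b a c = -S y a b c) (s₂₃ : ∀ y a b c, S y a c b = -S y a b c) :
    (∀ y a c, S y a a c = 0) ∧ (∀ y a b, S y a b b = 0) ∧ (∀ y a b, S y a b a = 0) ∧
      (∀ y a b c, S y b c a = S y a b c) ∧ (∀ y a b c, S y c b a = -S y a b c) := by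
  have cyc : ∀ y a b c, S y b c a = S y a b c := fun y a b c => by
    rw [s₂₃ y b a c, s₁₂ y a b c, neg_neg]
  refine ⟨fun y a c => self_eq_neg.1 (s₁₂ y a a c), fun y a b => self_eq_neg.1 (s₂₃ y a b b),
    fun y a b => ?_, cyc, fun y a b c => ?_⟩
  · rw [← cyc y a b a]
    exact self_eq_neg.1 (s₂₃ y b a a)
  · rw [s₁₂ y b c a, cyc y a b c]

/-- **Extensionality for totally alternating 3-tensors** (no `2`-torsion): two tensors, each
alternating under the two adjacent transpositions of the directions, agree as soon as they agree on
increasing direction triples `a < b < c`. [folklore] -/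
theorem LatticeChain.ext_of_alt₃ {T T' : ZdSite d → Fin d → Fin d → Fin d → A}
    (h₁₂ : ∀ y a b c, T y b a c = -T y a b c) (h₂₃ : ∀ y a b c, T y a c b = -T y a b c)
    (h₁₂' : ∀ y a b c, T' y b a c = -T' y a b c) (h₂₃' : ∀ y a b c, T' y a c b = -T' y a b c)
    (h : ∀ y a b c, a < b → b < c → T y a b c = T' y a b c) : T = T' := by
  obtain ⟨e₁, e₂, e₃, cyc, out⟩ := LatticeChain.alt₃_consequences h₁₂ h₂₃
  obtain ⟨e₁', e₂', e₃', cyc', out'⟩ := LatticeChain.alt₃_consequences h₁₂' h₂₃'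
  funext y a b c
  rcases lt_trichotomy a b with hab | rfl | hab
  · rcases lt_trichotomy b c with hbc | rfl | hbc
    · exact h y a b c hab hbc
    · rw [e₂, e₂']
    · rcases lt_trichotomy a c with hac | rfl | hac
      · rw [show T y a b c = -T y a c b by rw [h₂₃ y a b c, neg_neg],
          show T' y a b c = -T' y a c b by rw [h₂₃' y a b c, neg_neg], h y a c b hac hbc]
      · rw [e₃, e₃']
      · rw [cyc y c a b, cyc' y c a b]
        exact h y c a b hac hab
  · rw [e₁, e₁']
  · rcases lt_trichotomy a c with hac | rfl | hac
    · rw [h₁₂ y b a c, h₁₂' y b a c, h y b a c hab hac]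
    · rw [e₃, e₃']
    · rcases lt_trichotomy b c with hbc | rfl | hbc
      · rw [← cyc y a b c, ← cyc' y a b c]
        exact h y b c a hbc hac
      · rw [e₂, e₂']
      · rw [show T y a b c = -T y c b a by rw [out y a b c, neg_neg],
          show T' y a b c = -T' y c b a by rw [out' y a b c, neg_neg], h y c b a hbc hab]

end Ext

/-! ### Reading off a potential from a 3-chain -/

section OfChain

variable {A : Type*} [CommRing A]

variable (Λ) in
/-- Reading off a cube field from a 3-tensor: the coefficient of `(x; i, j, k)`, `i < j < k`. [folklore] -/
def ofChain₃ (Q : ZdSite d → Fin d → Fin d → Fin d → A) : ↥(cubesIn Λ) → A :=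
  fun q => Q (q : Cube d).1 (q : Cube d).2.1 (q : Cube d).2.2.1 (q : Cube d).2.2.2

/-- Reading off the cube field of `potChain Λ h` returns `h`. [folklore] -/
theorem ofChain₃_potChain (h : ↥(cubesIn Λ) → A) : ofChain₃ Λ (potChain Λ h) = h :=
  funext fun q => potChain_apply_of_mem h q.2

/-- An increasing non-vanishing entry of `potChain Λ h` is a cube of `Λ`. [folklore] -/
theorem mem_cubesIn_of_potChain_ne_zero (h : ↥(cubesIn Λ) → A) {y : ZdSite d} {a b c : Fin d}
    (hne : potChain Λ h y a b c ≠ 0) (hab : a < b) (hbc : b < c) : (y, a, b, c) ∈ cubesIn Λ := by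
  obtain ⟨q, hq, hy, ha, hb, hc, -, -, -⟩ := exists_of_potChain_ne_zero h hne
  obtain ⟨-, h1, h2, -⟩ := mem_cubesIn.1 hq
  have hdirs : q.2.1 = a ∧ q.2.2.1 = b ∧ q.2.2.2 = c := by omega
  have : q = (y, a, b, c) := Prod.ext hy.symm (Prod.ext hdirs.1 (Prod.ext hdirs.2.1 hdirs.2.2))
  exact this ▸ hq

/-- **A totally alternating 3-tensor whose increasing non-vanishing entries are cubes of `Λ` is the
`potChain` of its cube field** (no `2`-torsion). [folklore] -/
theorem potChain_ofChain₃ [IsAddTorsionFree A] {Q : ZdSite d → Fin d → Fin d → Fin d → A}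
    (h₁₂ : ∀ y a b c, Q y b a c = -Q y a b c) (h₂₃ : ∀ y a b c, Q y a c b = -Q y a b c)
    (hsupp : ∀ y a b c, a < b → b < c → Q y a b c ≠ 0 → (y, a, b, c) ∈ cubesIn Λ) :
    potChain Λ (ofChain₃ Λ Q) = Q := by
  refine LatticeChain.ext_of_alt₃ (potChain_swap₁₂ _) (potChain_swap₂₃ _) h₁₂ h₂₃
    fun y a b c hab hbc => ?_
  by_cases hmem : (y, a, b, c) ∈ cubesIn Λ
  · exact potChain_apply_of_mem (ofChain₃ Λ Q) hmem
  · have h0 : Q y a b c = 0 := by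
      by_contra h0
      exact hmem (hsupp y a b c hab hbc h0)
    rw [h0]
    by_contra h1
    exact hmem (mem_cubesIn_of_potChain_ne_zero _ h1 hab hbc)

end OfChain

/-! ### In a cube every closed integer plaquette field is the boundary of an integer potential -/

section Box

/-- The base point and the far corner of a cell squeezed into the cube `{-m,…,m}^d` lie in it.
[folklore] -/
theorem mem_box_of_bounds {m : ℕ} {y : ZdSite d} {i j k : Fin d} (hy : ∀ l, -(m : ℤ) ≤ y l)
    (ht : ∀ l, (y + e i + e j + e k) l ≤ m) : y ∈ box d m ∧ y + e i + e j + e k ∈ box d m := by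
  constructor <;> rw [mem_box] <;> intro l <;> have h1 := hy l <;> have h2 := ht l <;>
    simp only [e, Pi.add_apply, Pi.single_apply] at h2 ⊢ <;> split_ifs at h2 ⊢ <;> omega

/-- The remaining six corners of a cell whose base point and far corner lie in the cube
`{-m,…,m}^d` lie in it. [folklore] -/
theorem corners_mem_box {m : ℕ} {y : ZdSite d} {i j k : Fin d} (hy : y ∈ box d m)
    (ht : y + e i + e j + e k ∈ box d m) :
    y + e i ∈ box d m ∧ y + e j ∈ box d m ∧ y + e k ∈ box d m ∧ y + e i + e j ∈ box d m ∧
      y + e i + e k ∈ box d m ∧ y + e j + e k ∈ box d m := by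
  rw [mem_box] at hy ht
  refine ⟨?_, ?_, ?_, ?_, ?_, ?_⟩ <;> rw [mem_box] <;> intro l <;> have h1 := hy l <;> have h2 := ht l <;>
    simp only [e, Pi.add_apply, Pi.single_apply] at h2 ⊢ <;> split_ifs at h2 ⊢ <;> omega

/-- **Poincaré lemma for the cube, in plaquette-field language**: in `Λ = {-m,…,m}^d`, every integer
plaquette field satisfying the closed-flux constraint `∑ₚ cₚ ∂p = 0` is the boundary `bdPot Λ h`
of an integer potential `h` on the cubes of `Λ` (Fröhlich–Spencer's `*n = dα`, Lemma 1 with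
supports; here from `CubicalChainsPoincare.exists_bd₃_eq_of_bd₂_eq_zero`).
[cite: FrohlichSpencerCMP1982, §2.3 Lemma 1, §2.4 (2.21)–(2.22)] -/
theorem exists_bdPot_eq {m : ℕ} (c : ↥(plaquettesIn (box d m)) → ℤ)
    (hc : ∑ p, c p • plaqCurrent (p : Plaq d) = 0) :
    ∃ h : ↥(cubesIn (box d m)) → ℤ, bdPot (box d m) h = c := by
  have halt : IsAlt₂ (fluxChain (box d m) c) := isAlt₂_fluxChain c
  have hcl : bd₂ (fluxChain (box d m) c) = 0 := by
    rw [← div₂_eq_bd₂]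
    exact (sum_smul_plaqCurrent_eq_zero_iff c).1 hc
  have hsupp : ∀ y j k, fluxChain (box d m) c y j k ≠ 0 →
      (fun _ => -(m : ℤ)) ≤ y ∧ y + e j + e k ≤ fun _ => (m : ℤ) := by
    intro y j k hne
    rcases mem_or_mem_of_fluxChain_ne_zero c hne with hp | hp
    · obtain ⟨hy, -, -, -, hyjk⟩ := Plaq.mem_plaquettesIn.1 hp
      exact ⟨fun l => ((mem_box.1 hy) l).1, fun l => ((mem_box.1 hyjk) l).2⟩
    · obtain ⟨hy, -, -, -, hykj⟩ := Plaq.mem_plaquettesIn.1 hp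
      rw [add_right_comm] at hykj
      exact ⟨fun l => ((mem_box.1 hy) l).1, fun l => ((mem_box.1 hykj) l).2⟩
  obtain ⟨Q, hQalt, hQbd, hQsupp⟩ := exists_bd₃_eq_of_bd₂_eq_zero _ _ _ halt hcl hsupp
  have hpot : potChain (box d m) (ofChain₃ (box d m) Q) = Q := by
    refine potChain_ofChain₃ hQalt.1 hQalt.2 fun y a b k hab hbk hne => ?_
    obtain ⟨hlo, hhi⟩ := hQsupp y a b k hne
    obtain ⟨hy, ht⟩ := mem_box_of_bounds (i := a) (j := b) (k := k) (fun l => hlo l) (fun l => hhi l)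
    obtain ⟨c₁, c₂, c₃, c₄, c₅, c₆⟩ := corners_mem_box hy ht
    exact mem_cubesIn.2 ⟨hy, hab, hbk, c₁, c₂, c₃, c₄, c₅, c₆, ht⟩
  refine ⟨ofChain₃ (box d m) Q, funext fun p => ?_⟩
  rw [bdPot_apply, hpot, div₃_eq_bd₃, hQbd]
  exact congrFun (ofChain_fluxChain c) p

/-- The same in real form: the real plaquette field of a closed integer field is `bdPot` of the
real version of an integer potential. [folklore] -/
theorem exists_bdPot_intCast_eq {m : ℕ} (c : ↥(plaquettesIn (box d m)) → ℤ)
    (hc : ∑ p, c p • plaqCurrent (p : Plaq d) = 0) :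
    ∃ h : ↥(cubesIn (box d m)) → ℤ, bdPot (box d m) (fun q => (h q : ℝ)) = fun p => (c p : ℝ) := by
  obtain ⟨h, hh⟩ := exists_bdPot_eq c hc
  refine ⟨h, funext fun p => ?_⟩
  rw [bdPot_intCast, hh]

end Box

end Literature.MathematicalPhysics.QuantumFieldTheory
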